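import Mathlib
import Summits.ValiantsHypothesis.ValiantsHypothesis.Theorems.NewtonFramesCappedSlopeSum

/-!
# `NewtonTauWeak` (stmt-ValiantsHypothesis-5904), line `low-parallelism` — the PROVED part, ported as helpers

Support lemmas for the crux line `Cruxes/NewtonTauWeak/Lines/low_parallelism.lean` (val-idea-12 g2; critic val-idea-crit-3
VERDICT #12 PASS-WITH-PRICE, price P5 = this port).  Everything is stated over Mathlib constants only (no new `def`s): for
`A B : Finset ℝ` and a set `L : Finset (ℝ × ℝ)` of non-vertical lines `y = μ x + ν` (coded `(μ, ν)`),

* the INCIDENCE TRIPLES are `((A ×ˢ B) ×ˢ L).filter (fun q => q.1.2 = q.2.1 * q.1.1 + q.2.2)` (their number is `I(A × B, L)`),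
* the LANDINGS are their image under `q ↦ q.1.1 + q.2.1 / 2` (the abscissae `a + μ/2`; under `Φ(x,y) = (x, y - x²)` these are
  the points of the parabola lying in `{(a,a²)} + {(0,b)} + {(μ/2, μ²/4 - ν)}`),
* the SLOPE MULTIPLICITY of `μ` is `(L.filter fun l => l.1 = μ).card`.

Main results:
* `cartesianParabolaBound_of_landingLaw` — THE CAP REDUCTION (the lever of the line): a landing bound `≤ C (n+2)^{8/3-θ}`
  for line sets with `≤ (n+2)^{1/3+θ}` lines per slope implies the same bound with constant `C + 1` for ALL line sets with
  `≤ n²` lines (heavy slopes are `≤ n²/K` in number and give `≤ #A ≤ n` landings each — counting only, no structure theorem);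
* (companion file `NewtonFramesNewtonTauWeakParabolaDictionary.lean`: `cartesianParabolaBound_of_threeSetBound`, the parabola
  dictionary — the Cartesian–parabola landing bound is a NECESSARY sub-case of `ThreeSetBound` of line `landing-collapse`);
* `grid_incidences_le` — THE GRID WITNESS: on `A = B = {0,…,n-1}` a line set with `≤ K` lines per slope has
  `≤ n(2H+1)H·K + #L((n-1)/(H+1)+1)` incidences for every height cut `H` (from `CappedSlopeSum.card_linePts_le` /
  `mem_lowSlopes`, p601033);
* `card_incidences_pencil_le` — one pencil (all lines through a point `z`) carries `≤ #A·#B + #L` incidences.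

FRONTIER-disposition incidence geometry; VP ≠ VNP is not moved by any of this.
-/

set_option linter.dupNamespace false

open scoped BigOperators Pointwise

namespace Summit.ValiantsHypothesis.ValiantsHypothesis.Theorems.NewtonFramesNewtonTauWeak.LowParallelismCap

/-! ### 1. Counting lemmas -/

/-- Points of `A × B` on one non-vertical line number at most `#A` (the abscissa determines the point). -/
theorem card_ptsOn_le (A B : Finset ℝ) (s c : ℝ) :
    (((A ×ˢ B).filter fun x : ℝ × ℝ => x.2 = s * x.1 + c).card) ≤ A.card := by
  classical
  refine Finset.card_le_card_of_injOn Prod.fst (fun x hx => ?_) ?_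
  · exact (Finset.mem_product.1 (Finset.mem_filter.1 hx).1).1
  · intro x hx x' hx' h
    have h1 := (Finset.mem_filter.1 (Finset.mem_coe.1 hx)).2
    have h2 := (Finset.mem_filter.1 (Finset.mem_coe.1 hx')).2
    exact Prod.ext h (by rw [h1, h2, h])

/-- The incidence count is the sum over the lines of the per-line point counts. -/
theorem card_incidences_eq_sum (A B : Finset ℝ) (L : Finset (ℝ × ℝ)) :
    (((A ×ˢ B) ×ˢ L).filter (fun q : (ℝ × ℝ) × (ℝ × ℝ) => q.1.2 = q.2.1 * q.1.1 + q.2.2)).card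
      = ∑ l ∈ L, ((A ×ˢ B).filter fun x : ℝ × ℝ => x.2 = l.1 * x.1 + l.2).card := by
  classical
  rw [Finset.card_filter, Finset.sum_product_right]
  refine Finset.sum_congr rfl fun l _ => ?_
  rw [Finset.card_filter]

/-- Landings are at most incidences. -/
theorem card_landings_le_incidences (A B : Finset ℝ) (L : Finset (ℝ × ℝ)) :
    ((((A ×ˢ B) ×ˢ L).filter (fun q : (ℝ × ℝ) × (ℝ × ℝ) => q.1.2 = q.2.1 * q.1.1 + q.2.2)).image
        (fun q : (ℝ × ℝ) × (ℝ × ℝ) => q.1.1 + q.2.1 / 2)).card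
      ≤ (((A ×ˢ B) ×ˢ L).filter (fun q : (ℝ × ℝ) × (ℝ × ℝ) => q.1.2 = q.2.1 * q.1.1 + q.2.2)).card :=
  Finset.card_image_le

/-- Landings coming from lines with slope in a set `Hv` number at most `#Hv · #A` (one landing per (slope, abscissa)). -/
theorem card_landings_filter_le (A B : Finset ℝ) (L : Finset (ℝ × ℝ)) (Hv : Finset ℝ) :
    ((((A ×ˢ B) ×ˢ (L.filter fun l => l.1 ∈ Hv)).filter
        (fun q : (ℝ × ℝ) × (ℝ × ℝ) => q.1.2 = q.2.1 * q.1.1 + q.2.2)).image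
        (fun q : (ℝ × ℝ) × (ℝ × ℝ) => q.1.1 + q.2.1 / 2)).card ≤ Hv.card * A.card := by
  classical
  have hsub : (((A ×ˢ B) ×ˢ (L.filter fun l => l.1 ∈ Hv)).filter
        (fun q : (ℝ × ℝ) × (ℝ × ℝ) => q.1.2 = q.2.1 * q.1.1 + q.2.2)).image
        (fun q : (ℝ × ℝ) × (ℝ × ℝ) => q.1.1 + q.2.1 / 2) ⊆
      Hv.biUnion fun μ => A.image fun a => a + μ / 2 := by
    intro x hx
    simp only [Finset.mem_image, Finset.mem_filter, Finset.mem_product] at hx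
    obtain ⟨q, ⟨⟨⟨ha, _⟩, _, hμ⟩, _⟩, rfl⟩ := hx
    exact Finset.mem_biUnion.2 ⟨q.2.1, hμ, Finset.mem_image.2 ⟨q.1.1, ha, rfl⟩⟩
  refine (Finset.card_le_card hsub).trans ?_
  calc (Hv.biUnion fun μ => A.image fun a => a + μ / 2).card
      ≤ ∑ μ ∈ Hv, (A.image fun a => a + μ / 2).card := Finset.card_biUnion_le
    _ ≤ ∑ _μ ∈ Hv, A.card := Finset.sum_le_sum fun μ _ => Finset.card_image_le
    _ = Hv.card * A.card := by rw [Finset.sum_const, smul_eq_mul]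

/-- Splitting the line set by a predicate splits the landings. -/
theorem landings_subset_union (A B : Finset ℝ) (L : Finset (ℝ × ℝ)) (p : ℝ × ℝ → Prop) [DecidablePred p] :
    (((A ×ˢ B) ×ˢ L).filter (fun q : (ℝ × ℝ) × (ℝ × ℝ) => q.1.2 = q.2.1 * q.1.1 + q.2.2)).image
        (fun q : (ℝ × ℝ) × (ℝ × ℝ) => q.1.1 + q.2.1 / 2) ⊆
      (((A ×ˢ B) ×ˢ (L.filter p)).filter (fun q : (ℝ × ℝ) × (ℝ × ℝ) => q.1.2 = q.2.1 * q.1.1 + q.2.2)).image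
          (fun q : (ℝ × ℝ) × (ℝ × ℝ) => q.1.1 + q.2.1 / 2) ∪
        (((A ×ˢ B) ×ˢ (L.filter fun l => ¬ p l)).filter
            (fun q : (ℝ × ℝ) × (ℝ × ℝ) => q.1.2 = q.2.1 * q.1.1 + q.2.2)).image
          (fun q : (ℝ × ℝ) × (ℝ × ℝ) => q.1.1 + q.2.1 / 2) := by
  classical
  intro x hx
  simp only [Finset.mem_image, Finset.mem_filter, Finset.mem_product] at hx
  obtain ⟨q, ⟨⟨hab, hL⟩, heq⟩, rfl⟩ := hx
  by_cases hp : p q.2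
  · refine Finset.mem_union_left _ ?_
    simp only [Finset.mem_image, Finset.mem_filter, Finset.mem_product]
    exact ⟨q, ⟨⟨hab, hL, hp⟩, heq⟩, rfl⟩
  · refine Finset.mem_union_right _ ?_
    simp only [Finset.mem_image, Finset.mem_filter, Finset.mem_product]
    exact ⟨q, ⟨⟨hab, hL, hp⟩, heq⟩, rfl⟩

/-- The heavy slopes are few: if every slope in `Hv` carries more than `K` lines of `L`, then `#Hv · K ≤ #L`. -/
theorem card_heavySlopes_mul_le (L : Finset (ℝ × ℝ)) (K : ℝ) (Hv : Finset ℝ)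
    (hHv : ∀ μ ∈ Hv, K < ((L.filter fun l => l.1 = μ).card : ℝ)) : (Hv.card : ℝ) * K ≤ (L.card : ℝ) := by
  classical
  have h1 : (Hv.card : ℝ) * K ≤ ∑ μ ∈ Hv, ((L.filter fun l => l.1 = μ).card : ℝ) := by
    calc (Hv.card : ℝ) * K = ∑ _μ ∈ Hv, K := by rw [Finset.sum_const, nsmul_eq_mul]
      _ ≤ ∑ μ ∈ Hv, ((L.filter fun l => l.1 = μ).card : ℝ) := Finset.sum_le_sum fun μ hμ => (hHv μ hμ).le
  have h2 : ∑ μ ∈ Hv, (L.filter fun l => l.1 = μ).card ≤ L.card := by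
    rw [← Finset.card_biUnion]
    · exact Finset.card_le_card (Finset.biUnion_subset.2 fun μ _ => Finset.filter_subset _ _)
    · intro μ _ μ' _ hne
      simp only [Function.onFun]
      rw [Finset.disjoint_filter]
      intro l _ h1 h2
      exact hne (h1.symm.trans h2)
  have h2' : (∑ μ ∈ Hv, ((L.filter fun l => l.1 = μ).card : ℝ)) ≤ (L.card : ℝ) := by exact_mod_cast h2
  exact h1.trans h2'

/-- ONE PENCIL IS HARMLESS: if every line of `L` passes through the point `z`, then `I(A × B, L) ≤ #A·#B + #L`
(a point `≠ z` lies on at most one line through `z`; the point `z` itself on at most `#L`). -/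
theorem card_incidences_pencil_le (A B : Finset ℝ) (L : Finset (ℝ × ℝ)) (z : ℝ × ℝ)
    (hz : ∀ l ∈ L, z.2 = l.1 * z.1 + l.2) :
    (((A ×ˢ B) ×ˢ L).filter (fun q : (ℝ × ℝ) × (ℝ × ℝ) => q.1.2 = q.2.1 * q.1.1 + q.2.2)).card
      ≤ A.card * B.card + L.card := by
  classical
  have hsplit := Finset.card_filter_add_card_filter_not
    (s := ((A ×ˢ B) ×ˢ L).filter (fun q : (ℝ × ℝ) × (ℝ × ℝ) => q.1.2 = q.2.1 * q.1.1 + q.2.2))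
    (p := fun q : (ℝ × ℝ) × (ℝ × ℝ) => q.1 = z)
  have h1 : ((((A ×ˢ B) ×ˢ L).filter (fun q : (ℝ × ℝ) × (ℝ × ℝ) => q.1.2 = q.2.1 * q.1.1 + q.2.2)).filter
      fun q : (ℝ × ℝ) × (ℝ × ℝ) => q.1 = z).card ≤ L.card := by
    refine Finset.card_le_card_of_injOn (fun q => q.2) (fun q hq => ?_) ?_
    · exact (Finset.mem_product.1 (Finset.mem_filter.1 (Finset.mem_filter.1 hq).1).1).2
    · intro q hq q' hq' heq
      have h1 := (Finset.mem_filter.1 (Finset.mem_coe.1 hq)).2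
      have h2 := (Finset.mem_filter.1 (Finset.mem_coe.1 hq')).2
      exact Prod.ext (h1.trans h2.symm) heq
  have h2 : ((((A ×ˢ B) ×ˢ L).filter (fun q : (ℝ × ℝ) × (ℝ × ℝ) => q.1.2 = q.2.1 * q.1.1 + q.2.2)).filter
      fun q : (ℝ × ℝ) × (ℝ × ℝ) => ¬ q.1 = z).card ≤ A.card * B.card := by
    rw [← Finset.card_product]
    refine Finset.card_le_card_of_injOn (fun q => q.1) (fun q hq => ?_) ?_
    · exact (Finset.mem_product.1 (Finset.mem_filter.1 (Finset.mem_filter.1 hq).1).1).1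
    · intro q hq q' hq' heq
      have hq1 := Finset.mem_filter.1 (Finset.mem_coe.1 hq)
      have hq'1 := Finset.mem_filter.1 (Finset.mem_coe.1 hq')
      have hi : q.1.2 = q.2.1 * q.1.1 + q.2.2 := (Finset.mem_filter.1 hq1.1).2
      have hi' : q'.1.2 = q'.2.1 * q'.1.1 + q'.2.2 := (Finset.mem_filter.1 hq'1.1).2
      have hl : q.2 ∈ L := (Finset.mem_product.1 (Finset.mem_filter.1 hq1.1).1).2
      have hl' : q'.2 ∈ L := (Finset.mem_product.1 (Finset.mem_filter.1 hq'1.1).1).2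
      have hzl := hz _ hl
      have hzl' := hz _ hl'
      have heq1 : q.1 = q'.1 := heq
      have hne : q.1.1 ≠ z.1 := by
        intro hx
        apply hq1.2
        refine Prod.ext hx ?_
        rw [hi, hx, hzl]
      have e1 : q.1.2 = q'.2.1 * q.1.1 + q'.2.2 := by rw [heq1]; exact hi'
      have hμ : q.2.1 = q'.2.1 := by
        have h0 : (q.2.1 - q'.2.1) * (q.1.1 - z.1) = 0 := by linear_combination e1 - hi + hzl - hzl'
        rcases mul_eq_zero.1 h0 with h | h
        · exact sub_eq_zero.1 h
        · exact absurd (sub_eq_zero.1 h) hne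
      have hν : q.2.2 = q'.2.2 := by linear_combination hzl' - hzl - z.1 * hμ
      exact Prod.ext heq1 (Prod.ext hμ hν)
  omega

/-! ### 2. The cap reduction (the lever): WLOG low parallelism -/

/-- **THE CAP REDUCTION.**  If for some `θ > 0`, `C` every line set with `≤ n²` lines and `≤ (n+2)^{1/3+θ}` lines per slope
produces `≤ C (n+2)^{8/3-θ}` landings over every `A × B` with `#A, #B ≤ n`, then EVERY line set with `≤ n²` lines produces
`≤ (C+1) (n+2)^{8/3-θ}` landings: the slopes carrying `> K = (n+2)^{1/3+θ}` lines are `≤ n²/K` in number and give `≤ #A ≤ n`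
landings each (`≤ n³/K ≤ (n+2)^{8/3-θ}` in total), the remaining lines form a low-parallelism set. -/
theorem cartesianParabolaBound_of_landingLaw
    (hlaw : ∃ (θ C : ℝ), 0 < θ ∧ ∀ (n : ℕ) (A B : Finset ℝ) (L : Finset (ℝ × ℝ)),
      A.card ≤ n → B.card ≤ n → L.card ≤ n ^ 2 →
        (∀ μ : ℝ, ((L.filter fun l => l.1 = μ).card : ℝ) ≤ ((n : ℝ) + 2) ^ ((1 : ℝ) / 3 + θ)) →
          (((((A ×ˢ B) ×ˢ L).filter (fun q : (ℝ × ℝ) × (ℝ × ℝ) => q.1.2 = q.2.1 * q.1.1 + q.2.2)).image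
              (fun q : (ℝ × ℝ) × (ℝ × ℝ) => q.1.1 + q.2.1 / 2)).card : ℝ) ≤ C * ((n : ℝ) + 2) ^ ((8 : ℝ) / 3 - θ)) :
    ∃ (η C : ℝ), 0 < η ∧ ∀ (n : ℕ) (A B : Finset ℝ) (L : Finset (ℝ × ℝ)),
      A.card ≤ n → B.card ≤ n → L.card ≤ n ^ 2 →
        (((((A ×ˢ B) ×ˢ L).filter (fun q : (ℝ × ℝ) × (ℝ × ℝ) => q.1.2 = q.2.1 * q.1.1 + q.2.2)).image
            (fun q : (ℝ × ℝ) × (ℝ × ℝ) => q.1.1 + q.2.1 / 2)).card : ℝ) ≤ C * ((n : ℝ) + 2) ^ ((8 : ℝ) / 3 - η) := by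
  classical
  obtain ⟨θ, C, hθ, hlaw⟩ := hlaw
  refine ⟨θ, C + 1, hθ, ?_⟩
  intro n A B L hA hB hL
  -- abbreviations (local hypotheses only; no definitions)
  set lan : Finset (ℝ × ℝ) → Finset ℝ := fun M =>
    (((A ×ˢ B) ×ˢ M).filter (fun q : (ℝ × ℝ) × (ℝ × ℝ) => q.1.2 = q.2.1 * q.1.1 + q.2.2)).image
      (fun q : (ℝ × ℝ) × (ℝ × ℝ) => q.1.1 + q.2.1 / 2) with hlan
  set sm : Finset (ℝ × ℝ) → ℝ → ℕ := fun M μ => (M.filter fun l => l.1 = μ).card with hsm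
  change ((lan L).card : ℝ) ≤ (C + 1) * ((n : ℝ) + 2) ^ ((8 : ℝ) / 3 - θ)
  set N : ℝ := (n : ℝ) + 2 with hN
  have hN2 : (2 : ℝ) ≤ N := by rw [hN]; have := (Nat.cast_nonneg n : (0 : ℝ) ≤ n); linarith
  have hNpos : 0 < N := by linarith
  set K : ℝ := N ^ ((1 : ℝ) / 3 + θ) with hK
  have hKpos : 0 < K := Real.rpow_pos_of_pos hNpos _
  -- light / heavy split of the line set by slope multiplicity
  set light : ℝ × ℝ → Prop := fun l => (sm L l.1 : ℝ) ≤ K with hlight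
  set Ll := L.filter light with hLl
  set Lh := L.filter fun l => ¬ light l with hLh
  -- (i) the light part obeys the law
  have hLl_card : Ll.card ≤ n ^ 2 := (Finset.card_filter_le _ _).trans hL
  have hLl_mult : ∀ μ : ℝ, (sm Ll μ : ℝ) ≤ N ^ ((1 : ℝ) / 3 + θ) := by
    intro μ
    by_cases hμ : (sm L μ : ℝ) ≤ K
    · have : sm Ll μ ≤ sm L μ := by
        simp only [hsm]
        exact Finset.card_le_card (Finset.filter_subset_filter _ (Finset.filter_subset _ _))
      calc (sm Ll μ : ℝ) ≤ sm L μ := by exact_mod_cast this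
        _ ≤ K := hμ
    · have h0 : sm Ll μ = 0 := by
        simp only [hsm]
        rw [Finset.card_eq_zero, Finset.filter_eq_empty_iff]
        intro l hl hlμ
        rw [hLl, Finset.mem_filter] at hl
        apply hμ
        rw [← hlμ]
        exact hl.2
      rw [h0]; push_cast; exact (Real.rpow_pos_of_pos hNpos _).le
  have hland_l : ((lan Ll).card : ℝ) ≤ C * N ^ ((8 : ℝ) / 3 - θ) := hlaw n A B Ll hA hB hLl_card hLl_mult
  -- (ii) the heavy part: few slopes, `≤ n` landings each
  set Hv : Finset ℝ := (L.image Prod.fst).filter fun μ => K < (sm L μ : ℝ) with hHv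
  have hLh_eq : Lh = L.filter fun l => l.1 ∈ Hv := by
    rw [hLh]
    apply Finset.filter_congr
    intro l hl
    simp only [hlight, not_le, hHv, Finset.mem_filter, Finset.mem_image]
    constructor
    · intro h; exact ⟨⟨l, hl, rfl⟩, h⟩
    · intro h; exact h.2
  have hHvK : (Hv.card : ℝ) * K ≤ (n : ℝ) ^ 2 := by
    have := card_heavySlopes_mul_le L K Hv (fun μ hμ => (Finset.mem_filter.1 hμ).2)
    refine this.trans ?_
    exact_mod_cast hL
  have hland_h : ((lan Lh).card : ℝ) ≤ N ^ ((8 : ℝ) / 3 - θ) := by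
    have h1 : ((lan Lh).card : ℝ) ≤ (Hv.card : ℝ) * n := by
      rw [hLh_eq]
      have := card_landings_filter_le A B L Hv
      calc ((lan (L.filter fun l => l.1 ∈ Hv)).card : ℝ) ≤ (Hv.card : ℝ) * A.card := by
            exact_mod_cast this
        _ ≤ (Hv.card : ℝ) * n := by
            apply mul_le_mul_of_nonneg_left _ (Nat.cast_nonneg _)
            exact_mod_cast hA
    have hn_le : (n : ℝ) ≤ N := by rw [hN]; linarith
    have hn0 : (0 : ℝ) ≤ n := Nat.cast_nonneg n
    have h2 : (Hv.card : ℝ) * n * K ≤ N ^ (3 : ℝ) := by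
      calc (Hv.card : ℝ) * n * K = ((Hv.card : ℝ) * K) * n := by ring
        _ ≤ (n : ℝ) ^ 2 * n := mul_le_mul_of_nonneg_right hHvK hn0
        _ = (n : ℝ) ^ (3 : ℕ) := by ring
        _ ≤ N ^ (3 : ℕ) := pow_le_pow_left₀ hn0 hn_le 3
        _ = N ^ (3 : ℝ) := by rw [← Real.rpow_natCast]; norm_num
    have h3 : N ^ (3 : ℝ) = N ^ ((8 : ℝ) / 3 - θ) * K := by
      rw [hK, ← Real.rpow_add hNpos]; norm_num
    have h4 : (Hv.card : ℝ) * n ≤ N ^ ((8 : ℝ) / 3 - θ) := by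
      rw [h3] at h2
      exact le_of_mul_le_mul_right h2 hKpos
    exact h1.trans h4
  -- (iii) assemble
  have hsplit : (lan L).card ≤ (lan Ll).card + (lan Lh).card :=
    (Finset.card_le_card (landings_subset_union A B L light)).trans (Finset.card_union_le _ _)
  calc ((lan L).card : ℝ) ≤ (lan Ll).card + (lan Lh).card := by exact_mod_cast hsplit
    _ ≤ C * N ^ ((8 : ℝ) / 3 - θ) + N ^ ((8 : ℝ) / 3 - θ) := add_le_add hland_l hland_h
    _ = (C + 1) * N ^ ((8 : ℝ) / 3 - θ) := by ring

/-- The incidence form of the law implies the landing form (landings ≤ incidences), hence also feeds the cap reduction. -/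
theorem cartesianParabolaBound_of_incidenceLaw
    (hlaw : ∃ (θ C : ℝ), 0 < θ ∧ ∀ (n : ℕ) (A B : Finset ℝ) (L : Finset (ℝ × ℝ)),
      A.card ≤ n → B.card ≤ n → L.card ≤ n ^ 2 →
        (∀ μ : ℝ, ((L.filter fun l => l.1 = μ).card : ℝ) ≤ ((n : ℝ) + 2) ^ ((1 : ℝ) / 3 + θ)) →
          ((((A ×ˢ B) ×ˢ L).filter (fun q : (ℝ × ℝ) × (ℝ × ℝ) => q.1.2 = q.2.1 * q.1.1 + q.2.2)).card : ℝ)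
            ≤ C * ((n : ℝ) + 2) ^ ((8 : ℝ) / 3 - θ)) :
    ∃ (η C : ℝ), 0 < η ∧ ∀ (n : ℕ) (A B : Finset ℝ) (L : Finset (ℝ × ℝ)),
      A.card ≤ n → B.card ≤ n → L.card ≤ n ^ 2 →
        (((((A ×ˢ B) ×ˢ L).filter (fun q : (ℝ × ℝ) × (ℝ × ℝ) => q.1.2 = q.2.1 * q.1.1 + q.2.2)).image
            (fun q : (ℝ × ℝ) × (ℝ × ℝ) => q.1.1 + q.2.1 / 2)).card : ℝ) ≤ C * ((n : ℝ) + 2) ^ ((8 : ℝ) / 3 - η) := by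
  obtain ⟨θ, C, hθ, hlaw⟩ := hlaw
  refine cartesianParabolaBound_of_landingLaw ⟨θ, C, hθ, fun n A B L hA hB hL hpar => ?_⟩
  exact le_trans (by exact_mod_cast card_landings_le_incidences A B L) (hlaw n A B L hA hB hL hpar)

/-! ### 3. The grid witness: the law on Farey's home turf `A = B = {0,…,n-1}` -/

/-- **THE GRID WITNESS.**  On `A = B = {0,…,n-1}` a line set with `≤ K` lines per slope has, for every height cut `H`,
`I ≤ n·(2H+1)H·K + #L·((n-1)/(H+1) + 1)` incidences: the low slopes (height `≤ H`) are `≤ (2H+1)H` in number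
(`CappedSlopeSum.mem_lowSlopes`), carry `≤ K` lines of `≤ n` points each; a high-slope line meets the grid in
`≤ (n-1)/(H+1) + 1` points (`CappedSlopeSum.card_linePts_le`).  With `K = n^{1/3+θ}`, `H = (n²/K)^{1/3}` this is
`O(n^{22/9+θ/3}) ≤ n^{8/3-θ}` for `θ ≤ 1/6`. -/
theorem grid_incidences_le (n K H : ℕ) (L : Finset (ℝ × ℝ))
    (hK : ∀ μ : ℝ, (L.filter fun l => l.1 = μ).card ≤ K) :
    (((((Finset.range n).image (fun i : ℕ => (i : ℝ))) ×ˢ ((Finset.range n).image (fun i : ℕ => (i : ℝ)))) ×ˢ L).filter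
        (fun q : (ℝ × ℝ) × (ℝ × ℝ) => q.1.2 = q.2.1 * q.1.1 + q.2.2)).card
      ≤ n * ((2 * H + 1) * H) * K + L.card * ((n - 1) / (H + 1) + 1) := by
  classical
  set A : Finset ℝ := (Finset.range n).image (fun i : ℕ => (i : ℝ)) with hAdef
  have hAcard : A.card ≤ n := Finset.card_image_le.trans (by simp)
  -- the low slopes
  set G : Finset ℝ := ((Finset.range (2 * H + 1)) ×ˢ (Finset.range H)).image
    (fun p : ℕ × ℕ => ((p.1 : ℝ) - H) / ((p.2 : ℝ) + 1)) with hG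
  have hGcard : G.card ≤ (2 * H + 1) * H := by
    refine Finset.card_image_le.trans ?_
    simp [Finset.card_product]
  set F : ℝ × ℝ → ℕ := fun l => ((A ×ˢ A).filter fun x : ℝ × ℝ => x.2 = l.1 * x.1 + l.2).card with hF
  rw [card_incidences_eq_sum]
  change ∑ l ∈ L, F l ≤ _
  have hsplit := (Finset.sum_filter_add_sum_filter_not L (fun l => l.1 ∈ G) F).symm
  -- low-slope lines: at most `(2H+1)·H·K` of them, `≤ n` points each
  have hlow_card : (L.filter fun l => l.1 ∈ G).card ≤ ((2 * H + 1) * H) * K := by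
    have hsub : (L.filter fun l => l.1 ∈ G) ⊆ G.biUnion fun s => L.filter fun l => l.1 = s := by
      intro l hl
      rw [Finset.mem_filter] at hl
      exact Finset.mem_biUnion.2 ⟨l.1, hl.2, Finset.mem_filter.2 ⟨hl.1, rfl⟩⟩
    calc (L.filter fun l => l.1 ∈ G).card ≤ (G.biUnion fun s => L.filter fun l => l.1 = s).card :=
          Finset.card_le_card hsub
      _ ≤ ∑ s ∈ G, (L.filter fun l => l.1 = s).card := Finset.card_biUnion_le
      _ ≤ ∑ _s ∈ G, K := Finset.sum_le_sum fun s _ => hK s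
      _ = G.card * K := by rw [Finset.sum_const, smul_eq_mul]
      _ ≤ ((2 * H + 1) * H) * K := Nat.mul_le_mul_right K hGcard
  have hlow : ∑ l ∈ L.filter (fun l => l.1 ∈ G), F l ≤ n * ((2 * H + 1) * H) * K := by
    calc ∑ l ∈ L.filter (fun l => l.1 ∈ G), F l ≤ ∑ _l ∈ L.filter (fun l => l.1 ∈ G), n :=
          Finset.sum_le_sum fun l _ => (card_ptsOn_le A A l.1 l.2).trans hAcard
      _ = (L.filter fun l => l.1 ∈ G).card * n := by rw [Finset.sum_const, smul_eq_mul]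
      _ ≤ ((2 * H + 1) * H) * K * n := Nat.mul_le_mul_right n hlow_card
      _ = n * ((2 * H + 1) * H) * K := by ring
  -- high-slope lines: `≤ (n-1)/(H+1) + 1` points each
  have hhigh : ∑ l ∈ L.filter (fun l => ¬ l.1 ∈ G), F l ≤ L.card * ((n - 1) / (H + 1) + 1) := by
    have hper : ∀ l ∈ L.filter (fun l => ¬ l.1 ∈ G), F l ≤ (n - 1) / (H + 1) + 1 := by
      intro l hl
      have hlG : l.1 ∉ G := (Finset.mem_filter.1 hl).2
      have hs : ∀ q : ℚ, (q : ℝ) = l.1 → ¬ (|q.num| ≤ H ∧ q.den ≤ H) := by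
        intro q hq hqH
        apply hlG
        rw [← hq]
        exact Summit.ValiantsHypothesis.ValiantsHypothesis.Theorems.NewtonFramesNewtonTauWeak.CappedSlopeSum.mem_lowSlopes
          H q hqH.1 hqH.2
      -- transport to lattice points
      set A' : Finset (ℕ × ℕ) := ((Finset.range n) ×ˢ (Finset.range n)).filter
        (fun x : ℕ × ℕ => (x.2 : ℝ) = l.1 * (x.1 : ℝ) + l.2) with hA'
      have hA'b : A'.card ≤ (n - 1) / (H + 1) + 1 := by
        refine Summit.ValiantsHypothesis.ValiantsHypothesis.Theorems.NewtonFramesNewtonTauWeak.CappedSlopeSum.card_linePts_le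
          n H l.1 l.2 A' (fun x hx => ?_) hs
        simp only [hA', Finset.mem_filter, Finset.mem_product, Finset.mem_range] at hx
        exact ⟨hx.1.1, hx.1.2, hx.2⟩
      have hsub : ((A ×ˢ A).filter fun x : ℝ × ℝ => x.2 = l.1 * x.1 + l.2) ⊆
          A'.image (fun x : ℕ × ℕ => ((x.1 : ℝ), (x.2 : ℝ))) := by
        intro x hx
        simp only [Finset.mem_filter, Finset.mem_product, hAdef, Finset.mem_image, Finset.mem_range] at hx
        obtain ⟨⟨⟨i, hi, hix⟩, ⟨j, hj, hjx⟩⟩, heq⟩ := hx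
        refine Finset.mem_image.2 ⟨(i, j), ?_, ?_⟩
        · simp only [hA', Finset.mem_filter, Finset.mem_product, Finset.mem_range]
          refine ⟨⟨hi, hj⟩, ?_⟩
          rw [hix, hjx]; exact heq
        · exact Prod.ext hix hjx
      calc F l ≤ (A'.image (fun x : ℕ × ℕ => ((x.1 : ℝ), (x.2 : ℝ)))).card := Finset.card_le_card hsub
        _ ≤ A'.card := Finset.card_image_le
        _ ≤ (n - 1) / (H + 1) + 1 := hA'b
    calc ∑ l ∈ L.filter (fun l => ¬ l.1 ∈ G), F l
        ≤ ∑ _l ∈ L.filter (fun l => ¬ l.1 ∈ G), ((n - 1) / (H + 1) + 1) := Finset.sum_le_sum hper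
      _ = (L.filter (fun l => ¬ l.1 ∈ G)).card * ((n - 1) / (H + 1) + 1) := by
          rw [Finset.sum_const, smul_eq_mul]
      _ ≤ L.card * ((n - 1) / (H + 1) + 1) := Nat.mul_le_mul_right _ (Finset.card_filter_le _ _)
  rw [hsplit]
  exact Nat.add_le_add hlow hhigh

end Summit.ValiantsHypothesis.ValiantsHypothesis.Theorems.NewtonFramesNewtonTauWeak.LowParallelismCap
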